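import Summits.ABC.ABC.Theses.TwistAmplification
import Literature.NumberTheory.DiophantineGeometry.AbcWave0QualityFormProofs

/-!
# `TwistAmplification.SharpCountSandwich` (stmt-ABC-2793) — counting lemmas and the level sum

Support file (1/2) for the proof of the route item `SharpCountSandwich`
(`ABC → MazurKaneLaw →` sharp Frey–twist window count `≤ C X^{1-κ/6+ε}` for all `3 < κ < 6 < σ`),
which is closed in `TwistAmplificationSharpCountSandwich.lean`. Contents:

* `sum_rpow_neg_le_of_card_filter_le` — dyadic weighted count: if `#{c < 2^{j+1}} ≤ A (2^{j+1})^{β+γ}` for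
  all `j` and all `c < 2^{J+1}`, then `Σ c^{-β} ≤ (J+1) A 2^{β+γ} (2^J)^γ`;
* `card_le_sum_image_of_fiber_bound` — `#S ≤ Σ_{T ∈ f(S)} B T` when `t ↦ (f t, g t)` is injective on `S`
  and `1 ≤ g t ≤ B (f t)` (each fibre injects into `{1, …, ⌊B T⌋}`);
* `level_sum_le` — THE WEIGHTED MAZUR–KANE SUM: for a finset `F` of abc triples with `c ≤ N₀` and
  `rad ≤ c^{1+mδ}`, given the Mazur–Kane counts `#{T : c ≤ N, rad ≤ c^{1+kδ}} ≤ A N^{kδ+ε₁}` at the grid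
  levels `k = 1, …, m` (hypothesis `hMK`, the finset form of the route's `MazurKaneLaw` at
  `s = 1 + kδ ∈ (1,2)`) and the abc bound `c ≤ K rad^{1+τ}` (hypothesis `hABC`),
  `Σ_{T ∈ F} c_T / rad_T ≤ m · 4AK (log₂ N₀ + 1) N₀^{τ+δ+ε₁}`.
  Proof: a triple has LEVEL `k = max(1, ⌈(s_T - 1)/δ⌉)`, `s_T = log rad / log c`, so that `rad ≤ c^{1+kδ}`
  and, for `k ≥ 2`, `c^{1+(k-1)δ} < rad`. On level `1` the weight `c/rad` is `≤ K N₀^τ` (abc) and the count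
  is `≤ A N₀^{δ+ε₁}`; on level `k ≥ 2` the weight is `≤ c^{-(k-1)δ}` and the dyadic weighted count gives
  `≤ (log₂ N₀ + 1) · A · 2^{kδ+ε₁} · N₀^{δ+ε₁}`. Summing over the `m` levels gives the claim.

Only Mathlib, the route file and `IsABCTriple.two_le{,_rad}` (AbcWave0QualityFormProofs) are used.
-/

-- `Summit.<Summit>.<Problem>` is the mandated summit-side namespace (CONVENTIONS §2); for the
-- single-conjunct summit `ABC` the two coincide, so the duplicate `ABC.ABC` is deliberate.
set_option linter.dupNamespace false

namespace Summit.ABC.ABC.Theorems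

open Literature.NumberTheory.DiophantineGeometry

namespace SharpCountSandwich

/-! ## Generic counting lemmas -/

/-- **Dyadic weighted count.** If the elements of `G` with `c < 2^{j+1}` number at most `A (2^{j+1})^{β+γ}`
for every `j`, and all `c < 2^{J+1}`, then `Σ_{G} c^{-β} ≤ (J+1) · A 2^{β+γ} (2^J)^γ`. [folklore] -/
theorem sum_rpow_neg_le_of_card_filter_le {α : Type*} (G : Finset α) (c : α → ℕ) {β γ A : ℝ} (J : ℕ)
    (hβ : 0 ≤ β) (hγ : 0 ≤ γ) (hA : 0 ≤ A) (hc1 : ∀ T ∈ G, 1 ≤ c T)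
    (hcJ : ∀ T ∈ G, c T < 2 ^ (J + 1))
    (hcount : ∀ j : ℕ, ((G.filter (fun T => c T < 2 ^ (j + 1))).card : ℝ) ≤
      A * ((2 : ℝ) ^ (j + 1)) ^ (β + γ)) :
    ∑ T ∈ G, ((c T : ℝ)) ^ (-β) ≤ (J + 1) * (A * (2 : ℝ) ^ (β + γ) * ((2 : ℝ) ^ J) ^ γ) := by
  classical
  set M : ℝ := A * (2 : ℝ) ^ (β + γ) * ((2 : ℝ) ^ J) ^ γ with hM
  have hmaps : ∀ T ∈ G, Nat.log 2 (c T) ∈ Finset.range (J + 1) := by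
    intro T hT
    rw [Finset.mem_range]
    exact (Nat.log_lt_iff_lt_pow (by norm_num) (by have := hc1 T hT; omega)).mpr (hcJ T hT)
  rw [← Finset.sum_fiberwise_of_maps_to hmaps]
  have hfib : ∀ j ∈ Finset.range (J + 1),
      ∑ T ∈ G.filter (fun T => Nat.log 2 (c T) = j), ((c T : ℝ)) ^ (-β) ≤ M := by
    intro j hj
    rw [Finset.mem_range] at hj
    have hjJ : j ≤ J := by omega
    have h2j : (0 : ℝ) < (2 : ℝ) ^ j := by positivity
    have hlow : ∀ T ∈ G.filter (fun T => Nat.log 2 (c T) = j), (2 : ℝ) ^ j ≤ (c T : ℝ) := by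
      intro T hT
      rw [Finset.mem_filter] at hT
      have h := Nat.pow_log_le_self 2 (x := c T) (by have := hc1 T hT.1; omega)
      rw [hT.2] at h
      exact_mod_cast h
    have hcard : ((G.filter (fun T => Nat.log 2 (c T) = j)).card : ℝ) ≤
        A * ((2 : ℝ) ^ (j + 1)) ^ (β + γ) := by
      refine le_trans ?_ (hcount j)
      have hsub : G.filter (fun T => Nat.log 2 (c T) = j) ⊆ G.filter (fun T => c T < 2 ^ (j + 1)) := by
        intro T hT
        rw [Finset.mem_filter] at hT ⊢
        refine ⟨hT.1, ?_⟩
        have h := Nat.lt_pow_succ_log_self (b := 2) (by norm_num) (c T)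
        rw [hT.2] at h
        exact h
      exact_mod_cast Finset.card_le_card hsub
    have key : ((2 : ℝ) ^ (j + 1)) ^ (β + γ) * ((2 : ℝ) ^ j) ^ (-β) = (2 : ℝ) ^ (β + γ) * ((2 : ℝ) ^ j) ^ γ := by
      rw [pow_succ, Real.mul_rpow h2j.le (by norm_num : (0 : ℝ) ≤ 2)]
      have h : ((2 : ℝ) ^ j) ^ (β + γ) * ((2 : ℝ) ^ j) ^ (-β) = ((2 : ℝ) ^ j) ^ γ := by
        rw [← Real.rpow_add h2j, show β + γ + -β = γ by ring]
      calc ((2 : ℝ) ^ j) ^ (β + γ) * (2 : ℝ) ^ (β + γ) * ((2 : ℝ) ^ j) ^ (-β)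
          = (2 : ℝ) ^ (β + γ) * (((2 : ℝ) ^ j) ^ (β + γ) * ((2 : ℝ) ^ j) ^ (-β)) := by ring
        _ = (2 : ℝ) ^ (β + γ) * ((2 : ℝ) ^ j) ^ γ := by rw [h]
    calc ∑ T ∈ G.filter (fun T => Nat.log 2 (c T) = j), ((c T : ℝ)) ^ (-β)
        ≤ ∑ T ∈ G.filter (fun T => Nat.log 2 (c T) = j), ((2 : ℝ) ^ j) ^ (-β) := by
          refine Finset.sum_le_sum fun T hT => ?_
          exact Real.rpow_le_rpow_of_nonpos h2j (hlow T hT) (by linarith)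
      _ = ((G.filter (fun T => Nat.log 2 (c T) = j)).card : ℝ) * ((2 : ℝ) ^ j) ^ (-β) := by
          rw [Finset.sum_const, nsmul_eq_mul]
      _ ≤ A * ((2 : ℝ) ^ (j + 1)) ^ (β + γ) * ((2 : ℝ) ^ j) ^ (-β) :=
          mul_le_mul_of_nonneg_right hcard (Real.rpow_nonneg h2j.le _)
      _ = A * (2 : ℝ) ^ (β + γ) * ((2 : ℝ) ^ j) ^ γ := by rw [mul_assoc, key, mul_assoc]
      _ ≤ M := by
          rw [hM]
          refine mul_le_mul_of_nonneg_left ?_ (by positivity)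
          exact Real.rpow_le_rpow h2j.le (pow_le_pow_right₀ (by norm_num) hjJ) hγ
  calc ∑ j ∈ Finset.range (J + 1), ∑ T ∈ G.filter (fun T => Nat.log 2 (c T) = j), ((c T : ℝ)) ^ (-β)
      ≤ ∑ j ∈ Finset.range (J + 1), M := Finset.sum_le_sum hfib
    _ = (J + 1) * M := by
        rw [Finset.sum_const, Finset.card_range, nsmul_eq_mul]
        push_cast
        ring

/-- **Fibering.** If `t ↦ (f t, g t)` is injective on `S` and every `t ∈ S` has `1 ≤ g t ≤ B (f t)`, then
`#S ≤ Σ_{T ∈ f(S)} B T` (each fibre of `f` injects into `{1, …, ⌊B T⌋}`). [folklore] -/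
theorem card_le_sum_image_of_fiber_bound {ι M : Type*} [DecidableEq M] (S : Finset ι) (f : ι → M)
    (g : ι → ℕ) (B : M → ℝ) (hinj : ∀ t ∈ S, ∀ t' ∈ S, f t = f t' → g t = g t' → t = t')
    (hB : ∀ t ∈ S, 1 ≤ g t ∧ (g t : ℝ) ≤ B (f t)) :
    (S.card : ℝ) ≤ ∑ T ∈ S.image f, B T := by
  classical
  rw [Finset.card_eq_sum_card_image f S]
  push_cast
  refine Finset.sum_le_sum fun T hT => ?_
  obtain ⟨t₀, ht₀S, ht₀T⟩ := Finset.mem_image.mp hT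
  have hB0 : 0 ≤ B T := by
    have h := hB t₀ ht₀S
    rw [ht₀T] at h
    have : (1 : ℝ) ≤ g t₀ := by exact_mod_cast h.1
    linarith [h.2]
  have hcard : (S.filter (fun t => f t = T)).card ≤ ⌊B T⌋₊ := by
    calc (S.filter (fun t => f t = T)).card ≤ (Finset.Icc 1 ⌊B T⌋₊).card := by
          refine Finset.card_le_card_of_injOn g ?_ ?_
          · intro t ht
            have ht' : t ∈ S.filter (fun t => f t = T) := by simpa using ht
            rw [Finset.mem_filter] at ht'
            have h := hB t ht'.1
            rw [ht'.2] at h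
            simp only [Finset.coe_Icc, Set.mem_Icc]
            exact ⟨h.1, Nat.le_floor h.2⟩
          · intro t ht t' ht' hg
            have h1 : t ∈ S.filter (fun t => f t = T) := by simpa using ht
            have h2 : t' ∈ S.filter (fun t => f t = T) := by simpa using ht'
            rw [Finset.mem_filter] at h1 h2
            exact hinj t h1.1 t' h2.1 (h1.2.trans h2.2.symm) hg
      _ = ⌊B T⌋₊ := by simp
  calc ((S.filter (fun t => f t = T)).card : ℝ) ≤ (⌊B T⌋₊ : ℝ) := by exact_mod_cast hcard
    _ ≤ B T := Nat.floor_le hB0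

/-! ## The weighted Mazur–Kane sum over quality levels -/

/-- **Level sum.** With the Mazur–Kane bound `#{T : c ≤ N, r ≤ c^{1+kδ}} ≤ A N^{kδ+ε₁}` at the levels
`k = 1, …, m` and the abc bound `c ≤ K r^{1+τ}`, every finset `F` of abc triples with `c ≤ N₀` and
`r ≤ c^{1+mδ}` has `Σ_F c/r ≤ m · 4AK (log₂ N₀ + 1) N₀^{τ+δ+ε₁}`. [folklore] -/
theorem level_sum_le {δ ε₁ τ A K : ℝ} {m N₀ : ℕ} (hδ : 0 < δ) (hε₁ : 0 ≤ ε₁) (hε₁1 : ε₁ ≤ 1)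
    (hτ : 0 ≤ τ) (hA : 0 ≤ A) (hK : 1 ≤ K) (hm : 1 ≤ m) (hmδ : (m : ℝ) * δ ≤ 1) (hN₀ : 2 ≤ N₀)
    (hMK : ∀ k : ℕ, 1 ≤ k → k ≤ m → ∀ N : ℕ, 2 ≤ N → ∀ G : Finset (ℕ × ℕ × ℕ),
      (∀ T ∈ G, IsABCTriple T.1 T.2.1 T.2.2 ∧ T.2.2 ≤ N ∧
        ((rad T.1 T.2.1 T.2.2 : ℕ) : ℝ) ≤ (T.2.2 : ℝ) ^ (1 + k * δ)) →
      (G.card : ℝ) ≤ A * (N : ℝ) ^ (k * δ + ε₁))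
    (hABC : ∀ a b c : ℕ, IsABCTriple a b c → (c : ℝ) ≤ K * ((rad a b c : ℕ) : ℝ) ^ (1 + τ))
    (F : Finset (ℕ × ℕ × ℕ))
    (hF : ∀ T ∈ F, IsABCTriple T.1 T.2.1 T.2.2 ∧ T.2.2 ≤ N₀ ∧
      ((rad T.1 T.2.1 T.2.2 : ℕ) : ℝ) ≤ (T.2.2 : ℝ) ^ (1 + m * δ)) :
    ∑ T ∈ F, (T.2.2 : ℝ) / ((rad T.1 T.2.1 T.2.2 : ℕ) : ℝ) ≤
      m * (4 * A * K * (Nat.log 2 N₀ + 1) * (N₀ : ℝ) ^ (τ + δ + ε₁)) := by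
  classical
  set J := Nat.log 2 N₀ with hJ
  set B : ℝ := 4 * A * K * (J + 1) * (N₀ : ℝ) ^ (τ + δ + ε₁) with hB
  have hN₀1 : (1 : ℝ) ≤ (N₀ : ℝ) := by exact_mod_cast (by omega : 1 ≤ N₀)
  have hN₀0 : (0 : ℝ) < (N₀ : ℝ) := by linarith
  -- quality exponent and level of a triple
  let sT : ℕ × ℕ × ℕ → ℝ := fun T =>
    Real.log ((rad T.1 T.2.1 T.2.2 : ℕ) : ℝ) / Real.log (T.2.2 : ℝ)
  let lvl : ℕ × ℕ × ℕ → ℕ := fun T => max 1 ⌈(sT T - 1) / δ⌉₊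
  -- basic facts for `T ∈ F`
  have hbas : ∀ T ∈ F, (1 : ℝ) < (T.2.2 : ℝ) ∧ (0 : ℝ) < ((rad T.1 T.2.1 T.2.2 : ℕ) : ℝ) ∧
      ((rad T.1 T.2.1 T.2.2 : ℕ) : ℝ) = (T.2.2 : ℝ) ^ (sT T) ∧ sT T ≤ 1 + m * δ := by
    intro T hT
    obtain ⟨habc, -, hrc⟩ := hF T hT
    have hc1 : (1 : ℝ) < (T.2.2 : ℝ) := by exact_mod_cast habc.two_le
    have hc0 : (0 : ℝ) < (T.2.2 : ℝ) := by linarith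
    have hr0 : (0 : ℝ) < ((rad T.1 T.2.1 T.2.2 : ℕ) : ℝ) := by
      exact_mod_cast lt_of_lt_of_le (by norm_num) habc.two_le_rad
    have hlc : 0 < Real.log (T.2.2 : ℝ) := Real.log_pos hc1
    have hrs : ((rad T.1 T.2.1 T.2.2 : ℕ) : ℝ) = (T.2.2 : ℝ) ^ (sT T) := by
      rw [Real.rpow_def_of_pos hc0]
      simp only [sT]
      rw [← mul_div_assoc, mul_div_cancel_left₀ _ hlc.ne', Real.exp_log hr0]
    refine ⟨hc1, hr0, hrs, ?_⟩
    have h := Real.log_le_log hr0 hrc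
    rw [Real.log_rpow hc0] at h
    simp only [sT]
    rwa [div_le_iff₀ hlc]
  -- the level lies in `[1, m]`
  have hmaps : ∀ T ∈ F, lvl T ∈ Finset.Icc 1 m := by
    intro T hT
    obtain ⟨-, -, -, hs⟩ := hbas T hT
    rw [Finset.mem_Icc]
    refine ⟨le_max_left _ _, max_le hm (Nat.ceil_le.mpr ?_)⟩
    rw [div_le_iff₀ hδ]
    linarith
  -- the level pins the quality: `r ≤ c^{1+kδ}` and, for `k ≥ 2`, `c^{1+(k-1)δ} < r`
  have hlev : ∀ T ∈ F, ∀ k : ℕ, lvl T = k →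
      ((rad T.1 T.2.1 T.2.2 : ℕ) : ℝ) ≤ (T.2.2 : ℝ) ^ (1 + k * δ) ∧
      (2 ≤ k → (T.2.2 : ℝ) ^ (1 + ((k : ℝ) - 1) * δ) < ((rad T.1 T.2.1 T.2.2 : ℕ) : ℝ)) := by
    intro T hT k hk
    obtain ⟨hc1, hr0, hrs, hs⟩ := hbas T hT
    have hceil : (sT T - 1) / δ ≤ (⌈(sT T - 1) / δ⌉₊ : ℝ) := Nat.le_ceil _
    have hceilk : (⌈(sT T - 1) / δ⌉₊ : ℝ) ≤ (k : ℝ) := by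
      have : ⌈(sT T - 1) / δ⌉₊ ≤ lvl T := le_max_right _ _
      rw [hk] at this
      exact_mod_cast this
    constructor
    · rw [hrs]
      refine Real.rpow_le_rpow_of_exponent_le hc1.le ?_
      have h := hceil.trans hceilk
      rw [div_le_iff₀ hδ] at h
      linarith
    · intro hk2
      have hceq : ⌈(sT T - 1) / δ⌉₊ = k := by
        have h1 : lvl T = max 1 ⌈(sT T - 1) / δ⌉₊ := rfl
        rw [hk] at h1
        rcases le_or_gt ⌈(sT T - 1) / δ⌉₊ 1 with h | h
        · rw [max_eq_left h] at h1
          omega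
        · rw [max_eq_right h.le] at h1
          exact h1.symm
      have hlt : ((k - 1 : ℕ) : ℝ) < (sT T - 1) / δ := by
        rw [← Nat.lt_ceil, hceq]
        omega
      have hk1 : ((k - 1 : ℕ) : ℝ) = (k : ℝ) - 1 := by
        rw [Nat.cast_sub (by omega : 1 ≤ k)]
        simp
      rw [hk1, lt_div_iff₀ hδ] at hlt
      rw [hrs]
      refine Real.rpow_lt_rpow_of_exponent_lt hc1 ?_
      linarith
  -- per-level bound
  have hlevel : ∀ k ∈ Finset.Icc 1 m,
      ∑ T ∈ F.filter (fun T => lvl T = k), (T.2.2 : ℝ) / ((rad T.1 T.2.1 T.2.2 : ℕ) : ℝ) ≤ B := by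
    intro k hk
    rw [Finset.mem_Icc] at hk
    obtain ⟨hk1, hkm⟩ := hk
    set Fk := F.filter (fun T => lvl T = k) with hFk
    have hFk_mem : ∀ T ∈ Fk, T ∈ F ∧ lvl T = k := fun T hT => by simpa [hFk] using hT
    have hJ1 : (1 : ℝ) ≤ (J : ℝ) + 1 := by
      have : (0 : ℝ) ≤ (J : ℝ) := Nat.cast_nonneg J
      linarith
    have hNpow : (1 : ℝ) ≤ (N₀ : ℝ) ^ (τ + δ + ε₁) := Real.one_le_rpow hN₀1 (by linarith)
    rcases eq_or_lt_of_le hk1 with rfl | hk2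
    · -- level 1: weights `≤ K N₀^τ`, count `≤ A N₀^{δ+ε₁}`
      have hw : ∀ T ∈ Fk, (T.2.2 : ℝ) / ((rad T.1 T.2.1 T.2.2 : ℕ) : ℝ) ≤ K * (N₀ : ℝ) ^ τ := by
        intro T hT
        obtain ⟨hTF, -⟩ := hFk_mem T hT
        obtain ⟨hc1, hr0, -, -⟩ := hbas T hTF
        obtain ⟨habc, hcN, -⟩ := hF T hTF
        have hc0 : (0 : ℝ) < (T.2.2 : ℝ) := by linarith
        have hcN' : (T.2.2 : ℝ) ≤ (N₀ : ℝ) := by exact_mod_cast hcN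
        have hNτ : (1 : ℝ) ≤ (N₀ : ℝ) ^ τ := Real.one_le_rpow hN₀1 hτ
        rcases le_or_gt ((rad T.1 T.2.1 T.2.2 : ℕ) : ℝ) (T.2.2 : ℝ) with hrc | hcr
        · -- `r ≤ c`: `c ≤ K r^{1+τ} ≤ K r c^τ`
          have h1 := hABC _ _ _ habc
          have h2 : ((rad T.1 T.2.1 T.2.2 : ℕ) : ℝ) ^ (1 + τ) ≤
              ((rad T.1 T.2.1 T.2.2 : ℕ) : ℝ) * (N₀ : ℝ) ^ τ := by
            rw [Real.rpow_add hr0, Real.rpow_one]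
            refine mul_le_mul_of_nonneg_left ?_ hr0.le
            exact Real.rpow_le_rpow hr0.le (hrc.trans hcN') hτ
          rw [div_le_iff₀ hr0]
          calc (T.2.2 : ℝ) ≤ K * ((rad T.1 T.2.1 T.2.2 : ℕ) : ℝ) ^ (1 + τ) := h1
            _ ≤ K * (((rad T.1 T.2.1 T.2.2 : ℕ) : ℝ) * (N₀ : ℝ) ^ τ) :=
                mul_le_mul_of_nonneg_left h2 (by linarith)
            _ = K * (N₀ : ℝ) ^ τ * ((rad T.1 T.2.1 T.2.2 : ℕ) : ℝ) := by ring
        · -- `c < r`: the weight is `< 1`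
          have h1 : (T.2.2 : ℝ) / ((rad T.1 T.2.1 T.2.2 : ℕ) : ℝ) ≤ 1 := by
            rw [div_le_one hr0]
            exact hcr.le
          calc (T.2.2 : ℝ) / ((rad T.1 T.2.1 T.2.2 : ℕ) : ℝ) ≤ 1 := h1
            _ ≤ K * (N₀ : ℝ) ^ τ := by nlinarith
      have hcard : (Fk.card : ℝ) ≤ A * (N₀ : ℝ) ^ ((1 : ℕ) * δ + ε₁) := by
        refine hMK 1 le_rfl hkm N₀ hN₀ Fk fun T hT => ?_
        obtain ⟨hTF, hTk⟩ := hFk_mem T hT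
        obtain ⟨habc, hcN, -⟩ := hF T hTF
        exact ⟨habc, hcN, (hlev T hTF 1 hTk).1⟩
      calc ∑ T ∈ Fk, (T.2.2 : ℝ) / ((rad T.1 T.2.1 T.2.2 : ℕ) : ℝ)
          ≤ Fk.card • (K * (N₀ : ℝ) ^ τ) := Finset.sum_le_card_nsmul _ _ _ hw
        _ = (Fk.card : ℝ) * (K * (N₀ : ℝ) ^ τ) := nsmul_eq_mul _ _
        _ ≤ A * (N₀ : ℝ) ^ ((1 : ℕ) * δ + ε₁) * (K * (N₀ : ℝ) ^ τ) :=
            mul_le_mul_of_nonneg_right hcard (by positivity)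
        _ = A * K * (N₀ : ℝ) ^ (τ + δ + ε₁) := by
            rw [show τ + δ + ε₁ = ((1 : ℕ) * δ + ε₁) + τ by push_cast; ring, Real.rpow_add hN₀0 _ τ]
            ring
        _ ≤ B := by
            rw [hB]
            have hAK : 0 ≤ A * K * (N₀ : ℝ) ^ (τ + δ + ε₁) := by positivity
            nlinarith
    · -- level `k ≥ 2`: weights `≤ c^{-(k-1)δ}`, dyadic count
      have hk2' : 2 ≤ k := hk2
      set β : ℝ := ((k : ℝ) - 1) * δ with hβ
      set γ : ℝ := δ + ε₁ with hγ
      have hk1r : (1 : ℝ) ≤ (k : ℝ) := by exact_mod_cast hk1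
      have hβ0 : 0 ≤ β := mul_nonneg (by linarith) hδ.le
      have hγ0 : 0 ≤ γ := by positivity
      have hβγ : β + γ = k * δ + ε₁ := by rw [hβ, hγ]; ring
      have hβγ2 : β + γ ≤ 2 := by
        have hkm' : (k : ℝ) ≤ (m : ℝ) := by exact_mod_cast hkm
        rw [hβγ]
        nlinarith
      have hw : ∀ T ∈ Fk, (T.2.2 : ℝ) / ((rad T.1 T.2.1 T.2.2 : ℕ) : ℝ) ≤ ((T.2.2 : ℝ)) ^ (-β) := by
        intro T hT
        obtain ⟨hTF, hTk⟩ := hFk_mem T hT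
        obtain ⟨hc1, hr0, -, -⟩ := hbas T hTF
        have hc0 : (0 : ℝ) < (T.2.2 : ℝ) := by linarith
        have hlt := (hlev T hTF k hTk).2 hk2'
        calc (T.2.2 : ℝ) / ((rad T.1 T.2.1 T.2.2 : ℕ) : ℝ)
            ≤ (T.2.2 : ℝ) / (T.2.2 : ℝ) ^ (1 + ((k : ℝ) - 1) * δ) :=
              div_le_div_of_nonneg_left hc0.le (Real.rpow_pos_of_pos hc0 _) hlt.le
          _ = (T.2.2 : ℝ) ^ (-β) := by
              rw [hβ, show -(((k : ℝ) - 1) * δ) = 1 - (1 + ((k : ℝ) - 1) * δ) by ring,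
                Real.rpow_sub hc0, Real.rpow_one]
      have hD := sum_rpow_neg_le_of_card_filter_le Fk (fun T => T.2.2) J hβ0 hγ0 hA
        (fun T hT => by
          have := (hF T (hFk_mem T hT).1).1.two_le
          omega)
        (fun T hT => by
          have hcN := (hF T (hFk_mem T hT).1).2.1
          have := Nat.lt_pow_succ_log_self (b := 2) (by norm_num) N₀
          rw [← hJ] at this
          exact lt_of_le_of_lt hcN this)
        (fun j => by
          have h2 : 2 ≤ 2 ^ (j + 1) := by
            calc 2 = 2 ^ 1 := by norm_num
              _ ≤ 2 ^ (j + 1) := Nat.pow_le_pow_right (by norm_num) (by omega)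
          have h := hMK k hk1 hkm (2 ^ (j + 1)) h2 (Fk.filter (fun T => T.2.2 < 2 ^ (j + 1)))
            (fun T hT => by
              rw [Finset.mem_filter] at hT
              obtain ⟨hTF, hTk⟩ := hFk_mem T hT.1
              exact ⟨(hF T hTF).1, hT.2.le, (hlev T hTF k hTk).1⟩)
          rw [hβγ]
          push_cast at h
          exact h)
      have h2J : (((2 : ℝ) ^ J) : ℝ) ≤ (N₀ : ℝ) := by
        have := Nat.pow_log_le_self 2 (x := N₀) (by omega)
        rw [← hJ] at this
        exact_mod_cast this
      have hpow2 : (2 : ℝ) ^ (β + γ) ≤ 4 := by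
        calc (2 : ℝ) ^ (β + γ) ≤ (2 : ℝ) ^ (2 : ℝ) :=
              Real.rpow_le_rpow_of_exponent_le (by norm_num) hβγ2
          _ = 4 := by rw [Real.rpow_two]; norm_num
      have hpowJ : ((2 : ℝ) ^ J) ^ γ ≤ (N₀ : ℝ) ^ (τ + δ + ε₁) * K := by
        calc ((2 : ℝ) ^ J) ^ γ ≤ (N₀ : ℝ) ^ γ := Real.rpow_le_rpow (by positivity) h2J hγ0
          _ ≤ (N₀ : ℝ) ^ (τ + δ + ε₁) := by
              refine Real.rpow_le_rpow_of_exponent_le hN₀1 ?_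
              rw [hγ]
              linarith
          _ ≤ (N₀ : ℝ) ^ (τ + δ + ε₁) * K := by
              refine le_mul_of_one_le_right (by positivity) hK
      calc ∑ T ∈ Fk, (T.2.2 : ℝ) / ((rad T.1 T.2.1 T.2.2 : ℕ) : ℝ)
          ≤ ∑ T ∈ Fk, ((T.2.2 : ℝ)) ^ (-β) := Finset.sum_le_sum hw
        _ ≤ (J + 1) * (A * (2 : ℝ) ^ (β + γ) * ((2 : ℝ) ^ J) ^ γ) := hD
        _ ≤ (J + 1) * (A * 4 * ((N₀ : ℝ) ^ (τ + δ + ε₁) * K)) := by gcongr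
        _ = B := by rw [hB]; ring
  -- sum over the levels
  rw [← Finset.sum_fiberwise_of_maps_to hmaps]
  calc ∑ k ∈ Finset.Icc 1 m, ∑ T ∈ F.filter (fun T => lvl T = k),
        (T.2.2 : ℝ) / ((rad T.1 T.2.1 T.2.2 : ℕ) : ℝ)
      ≤ ∑ k ∈ Finset.Icc 1 m, B := Finset.sum_le_sum hlevel
    _ = m * B := by
        rw [Finset.sum_const, Nat.card_Icc, nsmul_eq_mul, Nat.add_sub_cancel]

end SharpCountSandwich

end Summit.ABC.ABC.Theorems
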